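import Literature.Analysis.FluidPDE.FiniteFourierModeEulerPolygonC

/-!
# Three faces of `S^{conv}` at the vertex of maximal length

Support file for `FiniteFourierModeEuler` (N. Kishimoto, T. Yoneda, J. Math. Fluid Mech. 24
(2022) 74 = arXiv:2110.08039). The proofs of Prop. 4.4 (iv) and Prop. 4.7 use that the symmetric
polyhedron `Ŝ^{conv}` "has at least six faces, and hence there exists a face `F̂` … such that
`A(F̂*) ≤ 2π/3`". We produce the faces concretely at the vertex `p₀` of maximal length (there the
face polygons of `FiniteFourierModeEulerPolygonB/C` are available): rotating supporting planes
(`exists_rotate`) gives a first two-dimensional face at `p₀` (`exists_facet`), and rotating its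
plane about its two edges at `p₀` away from it gives two more, pairwise distinct
(`exists_three_facets`). With their antipodes these are six distinct faces; the measure count is
in `FiniteFourierModeEulerFacetsB`.

## References

* [KishimotoYoneda2022] N. Kishimoto, T. Yoneda, J. Math. Fluid Mech. 24 (2022) 74 =
  arXiv:2110.08039, §4 proof of Prop. 4.4 (iv) ("`Ŝ^{conv}` … has at least six faces").
* [folklore] faces of a convex polytope by rotating supporting planes.
-/

noncomputable section

open Matrix Set Finset

namespace Literature.Analysis.FluidPDE

namespace KY

open scoped Classical

/-! ### Rotating a supporting plane about a face of its contact set -/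

/-- **Rotation of a supporting functional.** Let `φ` attain its maximum over `S` at `v`, let `g`
satisfy `g s ≤ g v` at all maximisers of `φ`, and let some point of `S` have `g > g v`. Then for
the smallest critical parameter `λ > 0`, `ψ = φ + λ g` is still maximal at `v`, is maximal at a
new point `w` with `g w > g v`, and its maximisers are old maximisers with `g = g v` or points with
`g > g v`. [folklore] (cf. `exists_exposed_edge_up`) -/
theorem exists_rotate {S : Finset (Fin 3 → ℝ)} {v φ g : Fin 3 → ℝ}
    (hmax : ∀ s ∈ S, φ ⬝ᵥ s ≤ φ ⬝ᵥ v) (hg : ∀ s ∈ S, φ ⬝ᵥ s = φ ⬝ᵥ v → g ⬝ᵥ s ≤ g ⬝ᵥ v)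
    (hup : ∃ s ∈ S, g ⬝ᵥ v < g ⬝ᵥ s) :
    ∃ lam : ℝ, 0 < lam ∧ ∃ w ∈ S, g ⬝ᵥ v < g ⬝ᵥ w ∧
      (φ + lam • g) ⬝ᵥ w = (φ + lam • g) ⬝ᵥ v ∧
      (∀ s ∈ S, (φ + lam • g) ⬝ᵥ s ≤ (φ + lam • g) ⬝ᵥ v) ∧
      (∀ s ∈ S, (φ + lam • g) ⬝ᵥ s = (φ + lam • g) ⬝ᵥ v →
        (φ ⬝ᵥ s = φ ⬝ᵥ v ∧ g ⬝ᵥ s = g ⬝ᵥ v) ∨ g ⬝ᵥ v < g ⬝ᵥ s) := by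
  set U := S.filter fun s => g ⬝ᵥ v < g ⬝ᵥ s with hU
  have hUne : U.Nonempty := by
    obtain ⟨s, hs, hgs⟩ := hup
    exact ⟨s, Finset.mem_filter.2 ⟨hs, hgs⟩⟩
  let crit : (Fin 3 → ℝ) → ℝ := fun s => (φ ⬝ᵥ v - φ ⬝ᵥ s) / (g ⬝ᵥ s - g ⬝ᵥ v)
  obtain ⟨w, hwU, hwmin⟩ := U.exists_min_image crit hUne
  obtain ⟨hwS, hgw⟩ := Finset.mem_filter.1 hwU
  -- points with larger `g` are strictly below in `φ`
  have hlt : ∀ s ∈ U, φ ⬝ᵥ s < φ ⬝ᵥ v := by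
    intro s hs
    obtain ⟨hsS, hgs⟩ := Finset.mem_filter.1 hs
    rcases (hmax s hsS).lt_or_eq with h | h
    · exact h
    · exact absurd (hg s hsS h) (not_le.2 hgs)
  have hcritpos : ∀ s ∈ U, 0 < crit s := fun s hs =>
    div_pos (sub_pos.2 (hlt s hs)) (sub_pos.2 (Finset.mem_filter.1 hs).2)
  refine ⟨crit w, hcritpos w hwU, w, hwS, hgw, ?_, ?_, ?_⟩
  · have hgw' : g ⬝ᵥ w - g ⬝ᵥ v ≠ 0 := (sub_pos.2 hgw).ne'
    simp only [add_dotProduct, smul_dotProduct, smul_eq_mul, crit]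
    field_simp
    ring
  · intro s hs
    simp only [add_dotProduct, smul_dotProduct, smul_eq_mul]
    by_cases hgs : g ⬝ᵥ v < g ⬝ᵥ s
    · have hle := hwmin s (Finset.mem_filter.2 ⟨hs, hgs⟩)
      have hden : 0 < g ⬝ᵥ s - g ⬝ᵥ v := sub_pos.2 hgs
      have : crit w * (g ⬝ᵥ s - g ⬝ᵥ v) ≤ φ ⬝ᵥ v - φ ⬝ᵥ s := by
        calc crit w * (g ⬝ᵥ s - g ⬝ᵥ v) ≤ crit s * (g ⬝ᵥ s - g ⬝ᵥ v) :=
              mul_le_mul_of_nonneg_right hle hden.le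
          _ = φ ⬝ᵥ v - φ ⬝ᵥ s := div_mul_cancel₀ _ hden.ne'
      nlinarith
    · rw [not_lt] at hgs
      have h1 := hmax s hs
      have h2 : crit w * g ⬝ᵥ s ≤ crit w * g ⬝ᵥ v := mul_le_mul_of_nonneg_left hgs (hcritpos w hwU).le
      linarith
  · intro s hs heq
    simp only [add_dotProduct, smul_dotProduct, smul_eq_mul] at heq
    by_cases hgs : g ⬝ᵥ v < g ⬝ᵥ s
    · exact Or.inr hgs
    · left
      rw [not_lt] at hgs
      have h1 := hmax s hs
      have h2 : crit w * g ⬝ᵥ s ≤ crit w * g ⬝ᵥ v := mul_le_mul_of_nonneg_left hgs (hcritpos w hwU).le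
      have h3 : φ ⬝ᵥ s = φ ⬝ᵥ v := by linarith
      refine ⟨h3, le_antisymm hgs ?_⟩
      have h4 : crit w * g ⬝ᵥ s = crit w * g ⬝ᵥ v := by linarith
      exact (mul_left_cancel₀ (hcritpos w hwU).ne' h4).ge

/-! ### Faces at the vertex of maximal length -/

/-- `φ` supports a two-dimensional face of `S^{conv}` at `p₀`, normalised to the level `1`:
`φ·s ≤ 1` on `S`, `φ·p₀ = 1`, and two points of the contact set are not collinear with `p₀`.
[cite: KishimotoYoneda2022, §4 (faces of `S^{conv}`, Props. 4.4–4.8)] -/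
def IsFacetAt (S : Finset (Fin 3 → ℝ)) (p₀ φ : Fin 3 → ℝ) : Prop :=
  (∀ s ∈ S, φ ⬝ᵥ s ≤ 1) ∧ φ ⬝ᵥ p₀ = 1 ∧
    ∃ a ∈ S, ∃ b ∈ S, φ ⬝ᵥ a = 1 ∧ φ ⬝ᵥ b = 1 ∧ p₀ ⬝ᵥ (a ⨯₃ b) ≠ 0

/-- A facet functional at the vertex of maximal length gives a `FaceCfg` at level `1`. [folklore] -/
theorem IsFacetAt.faceCfg {S : Finset (Fin 3 → ℝ)} {p₀ φ : Fin 3 → ℝ} (hφ : IsFacetAt S p₀ φ)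
    (hp₀ : p₀ ∈ S) (hfar : ∀ s ∈ S, s ≠ p₀ → p₀ ⬝ᵥ s < p₀ ⬝ᵥ p₀) : FaceCfg S φ p₀ 1 where
  hM := one_pos
  hmax := fun s hs => by rw [dotProduct_comm]; exact hφ.1 s hs
  hp₀ := hp₀
  hpM := by rw [dotProduct_comm]; exact hφ.2.1
  hfar := hfar
  h2 := by
    obtain ⟨a, ha, b, hb, haM, hbM, hab⟩ := hφ.2.2
    exact ⟨a, ha, b, hb, by rw [dotProduct_comm]; exact haM, by rw [dotProduct_comm]; exact hbM, hab⟩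

section Facets

variable {S : Finset (Fin 3 → ℝ)} {p₀ : Fin 3 → ℝ}

/-- A non-zero vector is not orthogonal to all of a spanning symmetric set: some point has positive
pairing. [folklore] -/
theorem exists_dot_pos (hsymm : ∀ s ∈ S, -s ∈ S)
    (hspan : ∃ a ∈ S, ∃ b ∈ S, ∃ c ∈ S, a ⬝ᵥ (b ⨯₃ c) ≠ 0) {g : Fin 3 → ℝ} (hg : g ≠ 0) :
    ∃ s ∈ S, 0 < g ⬝ᵥ s := by
  obtain ⟨a, ha, b, hb, c, hc, habc⟩ := hspan
  by_contra hno
  push Not at hno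
  have hz : ∀ s ∈ S, g ⬝ᵥ s = 0 := by
    intro s hs
    have h1 := hno s hs
    have h2 := hno (-s) (hsymm s hs)
    rw [dotProduct_neg] at h2
    linarith
  have key := congrArg (fun x => g ⬝ᵥ x) (cramer_triple a b c g)
  simp only [dotProduct_smul, dotProduct_add, smul_eq_mul, hz a ha, hz b hb, hz c hc, mul_zero,
    add_zero] at key
  have : g ⬝ᵥ g = 0 := (mul_eq_zero.1 key).resolve_left habc
  exact hg (dotProduct_self_eq_zero.1 this)

/-- **A first two-dimensional face at `p₀`.** Rotate the tangent plane `{p₀·x = |p₀|²}` about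
`p₀`; if the new contact set is collinear, rotate once more about that edge.
[cite: KishimotoYoneda2022, §4 Prop. 4.4 (`S^{conv}` is a polyhedron with faces at each vertex)] -/
theorem exists_facet (h0 : (0 : Fin 3 → ℝ) ∉ S) (hsymm : ∀ s ∈ S, -s ∈ S)
    (hspan : ∃ a ∈ S, ∃ b ∈ S, ∃ c ∈ S, a ⬝ᵥ (b ⨯₃ c) ≠ 0) (hp₀ : p₀ ∈ S)
    (hfar : ∀ s ∈ S, s ≠ p₀ → p₀ ⬝ᵥ s < p₀ ⬝ᵥ p₀) : ∃ φ : Fin 3 → ℝ, IsFacetAt S p₀ φ := by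
  have hp0 : p₀ ≠ 0 := fun h => h0 (h ▸ hp₀)
  have hρ : 0 < p₀ ⬝ᵥ p₀ := lt_of_le_of_ne
    (by rw [real_dot_eq]; nlinarith [sq_nonneg (p₀ 0), sq_nonneg (p₀ 1), sq_nonneg (p₀ 2)])
    (Ne.symm (real_dot_self_ne_zero hp0))
  set f : Fin 3 → ℝ := (p₀ ⬝ᵥ p₀)⁻¹ • p₀ with hf
  have hf1 : f ⬝ᵥ p₀ = 1 := by rw [hf, smul_dotProduct, smul_eq_mul, inv_mul_cancel₀ hρ.ne']
  have hfle : ∀ s ∈ S, f ⬝ᵥ s ≤ f ⬝ᵥ p₀ := by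
    intro s hs
    rw [hf, smul_dotProduct, smul_dotProduct, smul_eq_mul, smul_eq_mul]
    apply mul_le_mul_of_nonneg_left _ (inv_nonneg.2 hρ.le)
    by_cases hsp : s = p₀
    · rw [hsp]
    · exact (hfar s hs hsp).le
  have hfeq : ∀ s ∈ S, f ⬝ᵥ s = f ⬝ᵥ p₀ → s = p₀ := by
    intro s hs heq
    by_contra hsp
    have := hfar s hs hsp
    rw [hf, smul_dotProduct, smul_dotProduct, smul_eq_mul, smul_eq_mul] at heq
    have := mul_left_cancel₀ (inv_ne_zero hρ.ne') heq
    linarith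
  -- a direction `g ⊥ p₀`
  obtain ⟨a, ha, b, hb, c, hc, habc⟩ := hspan
  have hga : ∃ x ∈ S, p₀ ⨯₃ x ≠ 0 := by
    by_contra hno
    push Not at hno
    have e1 := eq_smul_of_cross_eq_zero hp0 (u := a) (by rw [← cross_anticomm, hno a ha, neg_zero])
    have e2 := eq_smul_of_cross_eq_zero hp0 (u := b) (by rw [← cross_anticomm, hno b hb, neg_zero])
    apply habc
    rw [e1, e2]
    simp [cross_apply, dotProduct, Fin.sum_univ_three]; ring
  obtain ⟨x, hx, hgx⟩ := hga
  set g := p₀ ⨯₃ x with hg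
  have hgp : g ⬝ᵥ p₀ = 0 := by rw [hg, dotProduct_comm, dot_self_cross]
  obtain ⟨s₀, hs₀, hgs₀⟩ := exists_dot_pos hsymm ⟨a, ha, b, hb, c, hc, habc⟩ hgx
  -- first rotation
  obtain ⟨lam, hlam, w, hw, hgw, hψw, hψmax, hψeq⟩ := exists_rotate (g := g) hfle
    (fun s hs heq => by rw [hfeq s hs heq]) ⟨s₀, hs₀, by rw [hgp]; exact hgs₀⟩
  set ψ := f + lam • g with hψ
  have hψ1 : ψ ⬝ᵥ p₀ = 1 := by
    rw [hψ, add_dotProduct, hf1, smul_dotProduct, hgp, smul_zero, add_zero]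
  have hwp : w ≠ p₀ := by rintro rfl; exact lt_irrefl _ hgw
  by_cases hcol : ∃ a' ∈ S, ∃ b' ∈ S, ψ ⬝ᵥ a' = 1 ∧ ψ ⬝ᵥ b' = 1 ∧ p₀ ⬝ᵥ (a' ⨯₃ b') ≠ 0
  · exact ⟨ψ, fun s hs => by rw [← hψ1]; exact hψmax s hs, hψ1, hcol⟩
  · -- the contact set of `ψ` is collinear through `p₀`: rotate about the line `p₀ w`
    push Not at hcol
    have hcol' : ∀ s ∈ S, ψ ⬝ᵥ s = 1 → p₀ ⬝ᵥ (w ⨯₃ s) = 0 := by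
      intro s hs hs1
      exact hcol w hw s hs (by rw [hψw, hψ1]) hs1
    set g₂ := p₀ ⨯₃ w with hg₂
    have hg₂p : g₂ ⬝ᵥ p₀ = 0 := by rw [hg₂, dotProduct_comm, dot_self_cross]
    have hg₂0 : g₂ ≠ 0 := by
      intro hz
      -- `w ∥ p₀`, but then `g w = 0`
      have := eq_smul_of_cross_eq_zero hp0 (u := w) (by rw [← cross_anticomm, ← hg₂, hz, neg_zero])
      rw [this, dotProduct_smul, hgp, smul_zero] at hgw
      exact lt_irrefl _ hgw
    obtain ⟨s₁, hs₁, hgs₁⟩ := exists_dot_pos hsymm ⟨a, ha, b, hb, c, hc, habc⟩ hg₂0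
    have hψmax' : ∀ s ∈ S, ψ ⬝ᵥ s ≤ ψ ⬝ᵥ p₀ := hψmax
    obtain ⟨lam₂, hlam₂, w₂, hw₂, hgw₂, hχw₂, hχmax, -⟩ := exists_rotate (g := g₂) hψmax'
      (fun s hs heq => by
        rw [hg₂p, hg₂, dotProduct_comm, ← FaceCfg.triple_eq_dot_cross]
        exact (hcol' s hs (by rw [heq, hψ1])).le) ⟨s₁, hs₁, by rw [hg₂p]; exact hgs₁⟩
    set χ := ψ + lam₂ • g₂ with hχ
    have hχ1 : χ ⬝ᵥ p₀ = 1 := by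
      rw [hχ, add_dotProduct, hψ1, smul_dotProduct, hg₂p, smul_zero, add_zero]
    refine ⟨χ, fun s hs => by rw [← hχ1]; exact hχmax s hs, hχ1, w, hw, w₂, hw₂, ?_, ?_, ?_⟩
    · rw [hχ, add_dotProduct, smul_dotProduct, hg₂, dotProduct_comm (p₀ ⨯₃ w) w, dot_cross_self,
        smul_zero, add_zero, hψw, hψ1]
    · rw [hχw₂, hχ1]
    · intro hz
      rw [hg₂p, hg₂, dotProduct_comm, ← FaceCfg.triple_eq_dot_cross, hz] at hgw₂
      exact lt_irrefl _ hgw₂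

/-- Two linear functionals agreeing on three linearly independent vectors agree everywhere.
[folklore] -/
theorem functional_eq_of_eq_on_triple {φ φ' a b c : Fin 3 → ℝ} (habc : a ⬝ᵥ (b ⨯₃ c) ≠ 0)
    (ha : φ ⬝ᵥ a = φ' ⬝ᵥ a) (hb : φ ⬝ᵥ b = φ' ⬝ᵥ b) (hc : φ ⬝ᵥ c = φ' ⬝ᵥ c) : φ = φ' := by
  -- `[a,b,c] (φ·x) = [x,b,c] φ·a + [a,x,c] φ·b + [a,b,x] φ·c`
  have key : ∀ x : Fin 3 → ℝ, φ ⬝ᵥ x = φ' ⬝ᵥ x := by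
    intro x
    have h1 := congrArg (fun v => φ ⬝ᵥ v) (cramer_triple a b c x)
    have h2 := congrArg (fun v => φ' ⬝ᵥ v) (cramer_triple a b c x)
    simp only [dotProduct_smul, dotProduct_add, smul_eq_mul] at h1 h2
    rw [ha, hb, hc, ← h2] at h1
    exact mul_left_cancel₀ habc h1
  -- a vector is determined by its pairings
  have : ∀ i, φ i = φ' i := by
    intro i
    have := key (Pi.single i 1)
    simpa [dotProduct_single] using this
  exact funext this

/-- **Rotating the plane of a face about one of its edges at `p₀`.** If the face of `φ₁` lies on
one side of the line `p₀ a` (`a` a contact point with `p₀ × a ≠ 0`, `σ [p₀, a, s] ≤ 0` for all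
contact points `s`), rotating about that line produces a different facet functional `φ₂` at `p₀`,
still of level `1` at `a`. [cite: KishimotoYoneda2022, §4 proof of Prop. 4.4 (iv) (adjacent faces of `S^{conv}`)] -/
theorem exists_rotate_about_edge (hsymm : ∀ s ∈ S, -s ∈ S)
    (hspan : ∃ a ∈ S, ∃ b ∈ S, ∃ c ∈ S, a ⬝ᵥ (b ⨯₃ c) ≠ 0) {φ₁ a : Fin 3 → ℝ}
    (hφ₁ : IsFacetAt S p₀ φ₁) (ha : a ∈ S) (ha1 : φ₁ ⬝ᵥ a = 1) (hk : p₀ ⨯₃ a ≠ 0) {σ : ℝ}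
    (hσ : σ ≠ 0) (hside : ∀ s ∈ S, φ₁ ⬝ᵥ s = 1 → σ * (p₀ ⬝ᵥ (a ⨯₃ s)) ≤ 0) :
    ∃ φ₂ : Fin 3 → ℝ, IsFacetAt S p₀ φ₂ ∧ φ₂ ≠ φ₁ ∧ φ₂ ⬝ᵥ a = 1 := by
  set n : Fin 3 → ℝ := σ • (p₀ ⨯₃ a) with hn
  have hnp : n ⬝ᵥ p₀ = 0 := by rw [hn, smul_dotProduct, dotProduct_comm, dot_self_cross, smul_zero]
  have hna : n ⬝ᵥ a = 0 := by rw [hn, smul_dotProduct, dotProduct_comm, dot_cross_self, smul_zero]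
  have hn0 : n ≠ 0 := by rw [hn]; exact smul_ne_zero hσ hk
  have hns : ∀ s : Fin 3 → ℝ, n ⬝ᵥ s = σ * (p₀ ⬝ᵥ (a ⨯₃ s)) := by
    intro s
    rw [hn, smul_dotProduct, smul_eq_mul, dotProduct_comm, ← FaceCfg.triple_eq_dot_cross]
  have hmax : ∀ s ∈ S, φ₁ ⬝ᵥ s ≤ φ₁ ⬝ᵥ p₀ := fun s hs => by rw [hφ₁.2.1]; exact hφ₁.1 s hs
  have hg : ∀ s ∈ S, φ₁ ⬝ᵥ s = φ₁ ⬝ᵥ p₀ → n ⬝ᵥ s ≤ n ⬝ᵥ p₀ := by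
    intro s hs heq
    rw [hnp, hns]
    exact hside s hs (by rw [heq, hφ₁.2.1])
  obtain ⟨s₀, hs₀, hns₀⟩ := exists_dot_pos hsymm hspan hn0
  obtain ⟨lam, hlam, w, hw, hnw, hψw, hψmax, -⟩ :=
    exists_rotate (g := n) hmax hg ⟨s₀, hs₀, by rw [hnp]; exact hns₀⟩
  set φ₂ := φ₁ + lam • n with hφ₂
  have hφ₂p : φ₂ ⬝ᵥ p₀ = 1 := by
    rw [hφ₂, add_dotProduct, hφ₁.2.1, smul_dotProduct, hnp, smul_zero, add_zero]
  have hφ₂a : φ₂ ⬝ᵥ a = 1 := by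
    rw [hφ₂, add_dotProduct, ha1, smul_dotProduct, hna, smul_zero, add_zero]
  refine ⟨φ₂, ⟨fun s hs => by rw [← hφ₂p]; exact hψmax s hs, hφ₂p, a, ha, w, hw, hφ₂a,
    by rw [hψw, hφ₂p], ?_⟩, ?_, hφ₂a⟩
  · -- `[p₀, a, w] ≠ 0` from `n·w > 0`
    intro hz
    rw [hnp, hns, hz, mul_zero] at hnw
    exact lt_irrefl _ hnw
  · intro heq
    have : lam • n = 0 := by
      have h1 : φ₁ + lam • n = φ₁ + 0 := by rw [add_zero, ← hφ₂, heq]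
      exact add_left_cancel h1
    rcases smul_eq_zero.1 this with h1 | h1
    · exact hlam.ne' h1
    · exact hn0 h1

/-- **Three pairwise distinct two-dimensional faces of `S^{conv}` at the vertex of maximal
length.** A first face (`exists_facet`), and the two faces obtained by rotating its plane about its
two edges at `p₀`. With their antipodes these are six distinct faces of the symmetric polyhedron
("`Ŝ^{conv}` has at least six faces"). [cite: KishimotoYoneda2022, §4 proof of Prop. 4.4 (iv)] -/
theorem exists_three_facets (h0 : (0 : Fin 3 → ℝ) ∉ S) (hsymm : ∀ s ∈ S, -s ∈ S)
    (hspan : ∃ a ∈ S, ∃ b ∈ S, ∃ c ∈ S, a ⬝ᵥ (b ⨯₃ c) ≠ 0) (hp₀ : p₀ ∈ S)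
    (hfar : ∀ s ∈ S, s ≠ p₀ → p₀ ⬝ᵥ s < p₀ ⬝ᵥ p₀) :
    ∃ φ₁ φ₂ φ₃ : Fin 3 → ℝ, IsFacetAt S p₀ φ₁ ∧ IsFacetAt S p₀ φ₂ ∧ IsFacetAt S p₀ φ₃ ∧
      φ₁ ≠ φ₂ ∧ φ₁ ≠ φ₃ ∧ φ₂ ≠ φ₃ := by
  obtain ⟨φ₁, hφ₁⟩ := exists_facet h0 hsymm hspan hp₀ hfar
  have cfg : FaceCfg S φ₁ p₀ 1 := hφ₁.faceCfg hp₀ hfar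
  set m := FaceCfg.nverts S φ₁ p₀ 1 with hm
  have hm2 : 2 ≤ m := cfg.two_le_nverts
  set q₁ := FaceCfg.poly S φ₁ p₀ 1 1 with hq₁
  set qm := FaceCfg.poly S φ₁ p₀ 1 m with hqm
  have hq₁F : q₁ ∈ face S φ₁ 1 := FaceCfg.poly_mem_face le_rfl (by omega)
  have hqmF : qm ∈ face S φ₁ 1 := FaceCfg.poly_mem_face (by omega) le_rfl
  obtain ⟨hq₁S, hq₁1⟩ := Finset.mem_filter.1 hq₁F
  obtain ⟨hqmS, hqm1⟩ := Finset.mem_filter.1 hqmF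
  rw [dotProduct_comm] at hq₁1 hqm1
  have hori : 0 < p₀ ⬝ᵥ (q₁ ⨯₃ qm) := cfg.triple_poly_pos le_rfl (by omega) le_rfl
  have hk₁ : p₀ ⨯₃ q₁ ≠ 0 := by
    intro hz
    have : p₀ ⬝ᵥ (q₁ ⨯₃ qm) = qm ⬝ᵥ (p₀ ⨯₃ q₁) := FaceCfg.triple_eq_dot_cross p₀ q₁ qm
    rw [this, hz, dotProduct_zero] at hori
    exact lt_irrefl _ hori
  have hkm : p₀ ⨯₃ qm ≠ 0 := by
    intro hz
    have : p₀ ⬝ᵥ (q₁ ⨯₃ qm) = -(q₁ ⬝ᵥ (p₀ ⨯₃ qm)) := by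
      rw [← cross_anticomm qm q₁, dotProduct_neg, FaceCfg.triple_eq_dot_cross p₀ qm q₁]
    rw [this, hz, dotProduct_zero, neg_zero] at hori
    exact lt_irrefl _ hori
  -- the face lies on one side of each of the two edges at `p₀`
  have hside₁ : ∀ s ∈ S, φ₁ ⬝ᵥ s = 1 → (-1 : ℝ) * (p₀ ⬝ᵥ (q₁ ⨯₃ s)) ≤ 0 := by
    intro s hs hs1
    have hsF : s ∈ face S φ₁ 1 := Finset.mem_filter.2 ⟨hs, by rw [dotProduct_comm]; exact hs1⟩
    have := (cfg.edge (j := 0) (Nat.zero_le _) hsF).1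
    rw [FaceCfg.poly_zero] at this
    linarith
  have hsidem : ∀ s ∈ S, φ₁ ⬝ᵥ s = 1 → (1 : ℝ) * (p₀ ⬝ᵥ (qm ⨯₃ s)) ≤ 0 := by
    intro s hs hs1
    have hsF : s ∈ face S φ₁ 1 := Finset.mem_filter.2 ⟨hs, by rw [dotProduct_comm]; exact hs1⟩
    have := (cfg.edge (j := m) le_rfl hsF).1
    have hsucc : FaceCfg.poly S φ₁ p₀ 1 (m + 1) = p₀ := FaceCfg.poly_succ_nverts
    rw [hsucc] at this
    change 0 ≤ qm ⬝ᵥ (p₀ ⨯₃ s) at this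
    have e : qm ⬝ᵥ (p₀ ⨯₃ s) = -(p₀ ⬝ᵥ (qm ⨯₃ s)) := by
      simp [cross_apply, dotProduct, Fin.sum_univ_three]; ring
    linarith
  obtain ⟨φ₂, hφ₂, h21, hφ₂q⟩ := exists_rotate_about_edge hsymm hspan hφ₁ hq₁S hq₁1 hk₁
    (by norm_num : (-1 : ℝ) ≠ 0) hside₁
  obtain ⟨φ₃, hφ₃, h31, hφ₃q⟩ := exists_rotate_about_edge hsymm hspan hφ₁ hqmS hqm1 hkm
    (by norm_num : (1 : ℝ) ≠ 0) hsidem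
  refine ⟨φ₁, φ₂, φ₃, hφ₁, hφ₂, hφ₃, Ne.symm h21, Ne.symm h31, ?_⟩
  intro h23
  apply h21
  -- `φ₂ = φ₃` agrees with `φ₁` at `p₀, q₁, q_m`, which are linearly independent
  exact functional_eq_of_eq_on_triple hori.ne' (by rw [hφ₂.2.1, hφ₁.2.1]) (by rw [hφ₂q, hq₁1])
    (by rw [h23, hφ₃q, hqm1])

end Facets

end KY

end Literature.Analysis.FluidPDE
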